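import Summits.PneNP.PneNP.Theses.DirichletPigeons
import Literature.Algebra.EuclideanLattices.SimultaneousApproximationLLLProofs
import Literature.Computability.Complexity.CodeFPRat
import Literature.Computability.Complexity.TimeBoundsProofs

/-!
# Route DirichletPigeons — `LllApproximateDirichlet` (stmt-PneNP-10865)

APPROXIMATE Dirichlet is in `FP`: on a valid instance `J = (⟨d, a⟩, b, Q)` (`1 ≤ b`, `1 ≤ Q`) output the denominator
`q` of LLL 1982 Prop. 1.39 (the PROVED tree fact `LLL1982_prop_1_39_holds`) run on `(y, ε) = ((aᵢ/b)ᵢ, 1/Q)` when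
`Q ≥ 2` (then `0 < ε < 1`, `1 ≤ q ≤ 2^{d(d+1)/4} Q^d ≤ 2^{⌊(d(d+1)+3)/4⌋} Q^d` and `‖q aᵢ/b‖ ≤ |q aᵢ/b − pᵢ| ≤ 1/Q`),
and on the fixed instance `([], 1/2)` when `Q = 1` (its `q` is forced to be `1`, and `‖·‖ ≤ 1/2 ≤ 1 = 1/Q`).
Polynomial time: the instance map is a typed `CodeFP` program (decode the vector, divide by `b`, form `1/Q`, branch),
composed (`PolyTimeComputable.comp_holds`) with the LLL machine and the projection to `q`.
-/

set_option linter.dupNamespace false -- `Summit.PneNP.PneNP.…`: summit = sub-problem name (D-0017 single-conjunct layout)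

namespace Summit.PneNP.PneNP.Theorems

open _root_.Computability
open Literature.Computability.Complexity Literature.Computability.Complexity.CodeFP
open Literature.Algebra.EuclideanLattices (encodeRat encodingRatBool simApproxInputEncoding simApproxOutputEncoding)

/-- The instance map of the approximate-Dirichlet algorithm on decoded data: `((d, [a₁,…,a_d]), (b, Q)) ↦ ((aᵢ/b)ᵢ, 1/Q)`
if `Q ≥ 2`, else the fixed instance `([], 1/2)`; computed on codes in polynomial time. [cite: AroraBarak2009, §1.3] [folklore] -/
theorem dirichletPigeons_codeFP_lllInput :
    CodeFP (pairE (pairE natE (listE smE)) (pairE natE natE)) (pairE (listE encodeRat) encodeRat)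
      fun t : (ℕ × List ℤ) × (ℕ × ℕ) =>
        if decide (2 ≤ t.2.2) then (t.1.2.map fun z : ℤ => ((z : ℤ) : ℚ) / (t.2.1 : ℚ), (1 : ℚ) / (t.2.2 : ℚ))
        else (([] : List ℚ), (1 / 2 : ℚ)) := by
  have hb : CodeFP (pairE (pairE natE (listE smE)) (pairE natE natE)) natE
      fun t : (ℕ × List ℤ) × (ℕ × ℕ) => t.2.1 := (CodeFP.snd _ _).fst'
  have hQ : CodeFP (pairE (pairE natE (listE smE)) (pairE natE natE)) natE
      fun t : (ℕ × List ℤ) × (ℕ × ℕ) => t.2.2 := (CodeFP.snd _ _).snd'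
  have hL : CodeFP (pairE (pairE natE (listE smE)) (pairE natE natE)) (rawE smE)
      fun t : (ℕ × List ℤ) × (ℕ × ℕ) => t.1.2 := ((rawOfList smE).comp (CodeFP.fst _ _).snd' :)
  have hitem : CodeFP (pairE natE smE) encodeRat fun p : ℕ × ℤ => ((p.2 : ℤ) : ℚ) / ((p.1 : ℕ) : ℚ) :=
    (ratOfIntNat.comp ((intOfSM.comp (CodeFP.snd _ _)).pair (CodeFP.fst _ _)) :)
  have hys : CodeFP (pairE (pairE natE (listE smE)) (pairE natE natE)) (listE encodeRat)
      fun t : (ℕ × List ℤ) × (ℕ × ℕ) => t.1.2.map fun z : ℤ => ((z : ℤ) : ℚ) / (t.2.1 : ℚ) :=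
    ((listOfRaw encodeRat).comp ((CodeFP.map hitem).comp (hb.pair hL)) :)
  have hε : CodeFP (pairE (pairE natE (listE smE)) (pairE natE natE)) encodeRat
      fun t : (ℕ × List ℤ) × (ℕ × ℕ) => (1 : ℚ) / (t.2.2 : ℚ) :=
    (ratOfIntNat.comp ((CodeFP.const _ (1 : ℤ)).pair hQ)).congr fun t => by simp
  have htest : CodeFP (pairE (pairE natE (listE smE)) (pairE natE natE)) bitE
      fun t : (ℕ × List ℤ) × (ℕ × ℕ) => decide (2 ≤ t.2.2) := (natLe.comp ((CodeFP.const _ 2).pair hQ) :)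
  exact htest.ite (hys.pair hε) (CodeFP.const _ (([] : List ℚ), (1 / 2 : ℚ)))

/-- **Support item `LllApproximateDirichlet` of route DirichletPigeons (stmt-PneNP-10865)**: approximate simultaneous
Dirichlet approximation in polynomial time, `1 ≤ q ≤ 2^{⌈d(d+1)/4⌉} Q^d`, `‖q aᵢ/b‖ ≤ 1/Q`, from LLL 1982 Prop. 1.39
(`LLL1982_prop_1_39_holds`) at `ε = 1/Q` (`Q = 1` by the fixed empty instance).
[cite: LenstraLenstraLovasz1982, Prop. 1.39] [cite: Bremner2011, Prop. 9.4] -/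
theorem dirichletPigeons_lllApproximateDirichlet_proof :
    Summit.PneNP.PneNP.Theses.DirichletPigeons.LllApproximateDirichlet := by
  obtain ⟨F, hFpoly, hF⟩ := Literature.Algebra.EuclideanLattices.LLL1982_prop_1_39_holds
  -- the typed instance map and its realisation on the route's codes
  let pre : ((Σ d : ℕ, Fin d → ℤ) × ℕ × ℕ) → List ℚ × ℚ := fun J =>
    if decide (2 ≤ J.2.2) then ((List.ofFn J.1.2).map fun z : ℤ => ((z : ℤ) : ℚ) / (J.2.1 : ℚ), (1 : ℚ) / (J.2.2 : ℚ))
    else (([] : List ℚ), (1 / 2 : ℚ))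
  have hconv : CodeFP
      ((Computability.Encoding.sigmaBool fun n => encodingFinVec encodingIntBool n).pairBool
        (encodingNatBool.pairBool encodingNatBool)).encode
      (pairE (pairE natE (listE smE)) (pairE natE natE))
      fun J : (Σ d : ℕ, Fin d → ℤ) × ℕ × ℕ => ((J.1.1, List.ofFn J.1.2), J.2) := by
    refine CodeFP.of_fn id (PolyTimeComputable.id _) fun J => ?_
    obtain ⟨⟨d, a⟩, b, Q⟩ := J
    show boolPair (boolPair (encodeNat d) (encodingIntBool.listBool.encode (List.ofFn a)))
        (boolPair (encodeNat b) (encodeNat Q)) = _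
    rw [listE_eq]
    rfl
  have hpre : CodeFP
      ((Computability.Encoding.sigmaBool fun n => encodingFinVec encodingIntBool n).pairBool
        (encodingNatBool.pairBool encodingNatBool)).encode
      simApproxInputEncoding.encode pre := by
    refine ((dirichletPigeons_codeFP_lllInput.comp hconv).recodeOut fun J => ?_).congr fun J => rfl
    show _ = (encodingRatBool.listBool.pairBool encodingRatBool).encode _
    rw [pairE_eq, listE_eq]
    rfl
  have hsnd : PolyTimeComputable simApproxOutputEncoding.encode encodeNat (Prod.snd : List ℤ × ℕ → ℕ) :=
    (CodeFP.snd (encodingIntBool.listBool.encode) natE).polyTimeComputable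
  have hcomp := PolyTimeComputable.comp_holds hsnd (PolyTimeComputable.comp_holds hFpoly hpre.polyTimeComputable)
  refine ⟨fun J => (F (pre J)).2, fun J hb hQ => ?_, hcomp⟩
  obtain ⟨⟨d, a⟩, b, Q⟩ := J
  simp only at hb hQ ⊢
  by_cases hQ2 : 2 ≤ Q
  · -- the LLL instance `((aᵢ/b)ᵢ, 1/Q)`
    have hpreJ : pre (⟨d, a⟩, b, Q) = ((List.ofFn a).map fun z : ℤ => ((z : ℤ) : ℚ) / (b : ℚ), (1 : ℚ) / (Q : ℚ)) := by
      simp only [pre, decide_eq_true hQ2, if_true]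
    have hQpos : (0 : ℚ) < Q := by exact_mod_cast (show 0 < Q by omega)
    have hε0 : (0 : ℚ) < 1 / Q := by positivity
    have hε1 : (1 : ℚ) / Q < 1 := by
      rw [div_lt_one hQpos]; exact_mod_cast hQ2
    obtain ⟨hlen, h1, hle, happ⟩ := hF ((List.ofFn a).map fun z : ℤ => ((z : ℤ) : ℚ) / (b : ℚ)) (1 / Q) hε0 hε1
    rw [hpreJ]
    refine ⟨h1, ?_, fun i => ?_⟩
    · -- `q ≤ 2^{d(d+1)/4} Q^d ≤ 2^{⌊(d(d+1)+3)/4⌋} Q^d`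
      have hlen' : ((List.ofFn a).map fun z : ℤ => ((z : ℤ) : ℚ) / (b : ℚ)).length = d := by simp
      rw [hlen'] at hle
      have hQinv : (((1 : ℚ) / Q : ℚ) : ℝ)⁻¹ = (Q : ℝ) := by push_cast; rw [one_div, inv_inv]
      rw [hQinv] at hle
      have hexp : (2 : ℝ) ^ ((d : ℝ) * (d + 1) / 4) ≤ (2 : ℝ) ^ (((d * (d + 1) + 3) / 4 : ℕ) : ℝ) := by
        refine Real.rpow_le_rpow_of_exponent_le one_le_two ?_
        have h4 : (d * (d + 1) : ℕ) ≤ 4 * ((d * (d + 1) + 3) / 4) := by omega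
        have h4' : ((d * (d + 1) : ℕ) : ℝ) ≤ 4 * (((d * (d + 1) + 3) / 4 : ℕ) : ℝ) := by exact_mod_cast h4
        push_cast at h4'
        linarith
      have hfin : ((F ((List.ofFn a).map fun z : ℤ => ((z : ℤ) : ℚ) / (b : ℚ), 1 / (Q : ℚ))).2 : ℝ) ≤
          ((2 ^ ((d * (d + 1) + 3) / 4) * Q ^ d : ℕ) : ℝ) := by
        refine hle.trans ?_
        rw [Real.rpow_natCast] at hexp
        push_cast
        gcongr
      exact_mod_cast hfin
    · -- `‖q aᵢ/b‖ ≤ |q aᵢ/b - pᵢ| ≤ 1/Q`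
      have hi : (i : ℕ) < ((List.ofFn a).map fun z : ℤ => ((z : ℤ) : ℚ) / (b : ℚ)).length := by simp
      have h := happ ⟨i, hi⟩
      have hget : ((List.ofFn a).map fun z : ℤ => ((z : ℤ) : ℚ) / (b : ℚ)).get ⟨i, hi⟩ = (a i : ℚ) / b := by
        simp
      rw [hget, ← mul_div_assoc] at h
      exact (round_le _ _).trans h
  · -- `Q = 1`: the fixed instance, `q = 1`
    have hQ1 : Q = 1 := by omega
    subst hQ1
    have hpreJ : pre (⟨d, a⟩, b, 1) = (([] : List ℚ), (1 / 2 : ℚ)) := by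
      simp [pre]
    obtain ⟨-, h1, hle, -⟩ := hF ([] : List ℚ) (1 / 2) (by norm_num) (by norm_num)
    have hq1 : (F ([], 1 / 2)).2 = 1 := by
      have : ((F ([], 1 / 2)).2 : ℝ) ≤ 1 := by simpa using hle
      have : (F ([], 1 / 2)).2 ≤ 1 := by exact_mod_cast this
      omega
    rw [hpreJ, hq1]
    refine ⟨le_rfl, Nat.one_le_iff_ne_zero.2 (by positivity), fun i => ?_⟩
    push_cast
    exact (abs_sub_round _).trans (by norm_num)

end Summit.PneNP.PneNP.Theorems
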